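import Mathlib
import HarnessLib
import Literature.Analysis.FluidPDE.ClassicalSolution
import Literature.Analysis.FluidPDE.VectorCalculus
import Summits.NavierStokesRegularity.NavierStokesRegularity.Theses.UnthreadedRigidityDoor
import Summits.NavierStokesRegularity.NavierStokesRegularity.Theorems.UnthreadedRigidityDoorUnthreadedRigidityProfileHornCompositions
import Summits.NavierStokesRegularity.NavierStokesRegularity.Theorems.UnthreadedRigidityDoorUnthreadedRigidityPressureHornAnalyticWedge

/-!
# Route `UnthreadedRigidityDoor`, item `UnthreadedRigidity` (W2, stmt-NavierStokesRegularity-27585) — LINE g10-1 «PRESSURE HORN»: the COMPOSITIONS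
# BY NAME, with every landed support and THEOREM PHR discharged (sorry-free)

Cell ns-regularity-ideate, K2 hand ns-poloidal-K2-p2 g13 (DIRECTOR-NS KEY-NS #186 / #281).  The sketch's four kernel compositions (planner ns-idea-6 g10,
`PressureHorn_sketch.lean` v1.1) restated over the Theorems-side twin `…Theorems.UnthreadedRigidity.PressureHorn` and SHARPENED by discharging what the tree
now proves: S-E `eulerVanishing_holds`, S-T `finiteTowerWedge_holds`, S-Z′ `zonalSepShellAxisym_holds` (`…PressureHornSupports.lean`), S-A
`analyticWedgeSeparable_holds` (`…PressureHornAnalyticWedge.lean`), THEOREM PHR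
`…ProfileHorn.profileHornRigidity_holds` (g10-2, p692614, ns-crc-p1 g7) and S-0 `sepShell` null (`…ProfileHorn.nullProfileShellZero_holds`, p690457).

* `isotypicOrderOneRigidity_of_identity : IsotypicOrderOneIdentity → IsotypicOrderOneRigidity` — rung I1 now waits on ONE bridge (DP2).
* `nestedHornExclusionFinite_of : NestedHornExclusion → NestedHornExclusionFinite` (S-T discharged).
* `isotypicOrderTwoRigidity_of_horns : IsotypicOrderOneIdentity → NestedHornExclusion → SeparableShellOrderTwoRigidity → IsotypicOrderTwoRigidity` and, with
  g10-2's `separableShellOrderTwoRigidity_of_identity`, `isotypicOrderTwoRigidity_of_bridges : IsotypicOrderOneIdentity → NestedHornExclusion → HornIdentityTwo →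
  IsotypicOrderTwoRigidity` — rung I2 from two NS→algebra bridges and the exclusion crux.
* `isotypicWindowRigidity_of_crux : UnthreadedRigidity → IsotypicWindowRigidity` (the window rung is literally below the wall item) and
  `isotypicWindowRigidity_of_bridges : WindowWedgeAnalytic → HornWindowSilenceVar → WindowAxisUniform → IsotypicWindowRigidity` — the `l = 2`-ISOTYPIC
  case of 27585 from the two NS→algebra bridges (W, PH-W′) and the common-axis support S-U ALONE; S-A, PHR, S-Z′, S-0 are discharged.

HONEST LABEL: compositions (bookkeeping theorems) of one line on the wall item; the bridges `IsotypicOrderOneIdentity` / `WindowWedgeAnalytic` /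
`HornWindowSilenceVar` (M), the support `WindowAxisUniform` (S–M) and the crux `NestedHornExclusion` remain HYPOTHESES;
⟨27585⟩ / W2 OPEN; NS regularity NOT proved.
-/

noncomputable section

-- the summit and its single sub-problem share the name (CONVENTIONS §1), as in every Theorems file
set_option linter.dupNamespace false

namespace Summit.NavierStokesRegularity.NavierStokesRegularity.Theorems.UnthreadedRigidity.PressureHorn

open Set Function Filter Topology
open Summit.NavierStokesRegularity.NavierStokesRegularity.Theorems.UnthreadedRigidity.ProfileHorn

/-! ## Slice level -/

/-- **COMPOSITION I1 (S-E discharged)**: the order-one Wronskian identity DP2 alone gives isotypic order-one rigidity. -/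
theorem isotypicOrderOneRigidity_of_identity (hM : IsotypicOrderOneIdentity) : IsotypicOrderOneRigidity := by
  intro t₀ T u p x₀ Q hT hsol hQa hdat hj1 r hr y hy
  refine eulerVanishing_holds Q y hQa ?_ r hr
  intro s hs
  have h1 := hM t₀ T u p x₀ Q hT hsol hQa hdat s hs y hy
  rw [hj1 (x₀ + s • y)] at h1
  have hc : (-24 : ℝ) * s⁻¹ ^ 3 ≠ 0 := mul_ne_zero (by norm_num) (pow_ne_zero 3 (inv_ne_zero hs.ne'))
  exact (mul_eq_zero.mp h1.symm).resolve_left hc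

/-- **bookkeeping (S-T discharged)**: the full exclusion crux gives the finite-tower target (the converse direction is the X∞ residual). -/
theorem nestedHornExclusionFinite_of (hX : NestedHornExclusion) : NestedHornExclusionFinite := by
  intro t₀ T u p x₀ Q hT hsol hp hQ hu h1 h2 hTow
  exact hX t₀ T u p x₀ Q hT hsol hp hQ hu h1 h2 (finiteTowerWedge_holds Q hQ hTow)

/-- **COMPOSITION I2**: DP2 ∧ X ∧ (g10-2's separable rung) ⇒ isotypic order-two rigidity (S-E discharged). -/
theorem isotypicOrderTwoRigidity_of_horns (hM : IsotypicOrderOneIdentity) (hX : NestedHornExclusion)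
    (hSep : SeparableShellOrderTwoRigidity) : IsotypicOrderTwoRigidity := by
  intro t₀ T u p x₀ Q hT hsol hp hQa hdat hj1 hj2
  have hW : WedgeVanishes Q := isotypicOrderOneRigidity_of_identity hM t₀ T u p x₀ Q hT hsol hQa hdat hj1
  obtain ⟨H, Q₀, hH, hQ₀, hsep⟩ := hX t₀ T u p x₀ Q hT hsol hp hQa hdat hj1 hj2 hW
  exact hSep t₀ T u p x₀ Q₀ H hT hsol hp hQ₀ hH hsep hj1 hj2

/-- **COMPOSITION I2′ (PHR, S-Z, S-0 discharged through g10-2's `separableShellOrderTwoRigidity_of_identity`)**: rung I2 from the two NS→algebra bridges DP2,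
PH and the exclusion crux X. -/
theorem isotypicOrderTwoRigidity_of_bridges (hM : IsotypicOrderOneIdentity) (hX : NestedHornExclusion) (hI : HornIdentityTwo) :
    IsotypicOrderTwoRigidity :=
  isotypicOrderTwoRigidity_of_horns hM hX (separableShellOrderTwoRigidity_of_identity hI)

/-! ## Window level -/

/-- **COMPOSITION I3 (bookkeeping)**: the window rung is a restriction of the crux — a genuine rung BELOW 27585. -/
theorem isotypicWindowRigidity_of_crux
    (h : Summit.NavierStokesRegularity.NavierStokesRegularity.Theses.UnthreadedRigidityDoor.UnthreadedRigidity) :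
    IsotypicWindowRigidity := by
  intro S hS hconn u x₀ hcont hdiv hmild hbdd hunth _
  exact h S hS hconn u x₀ hcont hdiv hmild hbdd hunth

/-- **COMPOSITION W (kernel-checked; S-A, PHR, S-Z′, S-0 DISCHARGED)**: the WINDOW rung — the crux 27585 restricted to isotypic `l = 2` windows — follows
from the two bridges W, PH-W′ and the common-axis support S-U. -/
theorem isotypicWindowRigidity_of_bridges (hWA : WindowWedgeAnalytic) (hHW : HornWindowSilenceVar) (hU : WindowAxisUniform) :
    IsotypicWindowRigidity := by
  intro S hS hconn u x₀ hcont hdiv hmild hbdd hunth hiso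
  choose! Qf hQa hQu using hiso
  have hsep : ∀ t ∈ S, ∃ (H : ℝ → ℝ) (Q₀ : Matrix (Fin 3) (Fin 3) ℝ),
      HornAdmissible H ∧ IsQuadForm Q₀ ∧ u t = sepShell H Q₀ x₀ := by
    intro t ht
    obtain ⟨hW, hA⟩ := hWA S hS u x₀ hcont hdiv hmild hbdd hunth Qf (fun t ht => ⟨hQa t ht, hQu t ht⟩) t ht
    obtain ⟨H, Q₀, hH, hQ₀, hHQ⟩ := analyticWedgeSeparable_holds (Qf t) (hQa t ht) hA hW
    refine ⟨H, Q₀, hH, hQ₀, ?_⟩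
    rw [hQu t ht]
    exact isoShell_eq_sepShell x₀ hHQ
  choose! Hf Q0f hHa hQ0 hHu using hsep
  have key := hHW S hS u x₀ hcont hdiv hmild hbdd Hf Q0f (fun t ht => ⟨hHa t ht, hQ0 t ht, hHu t ht⟩)
  have hax : ∀ t ∈ S, IsSliceAxisymmetric (u t) x₀ := by
    intro t ht
    rcases key t ht with hz | hhorn
    · rw [hHu t ht]
      exact zonalSepShellAxisym_holds (Q0f t) (Hf t) x₀ (hQ0 t ht) hz (hHa t ht)
    · have hH0 : ∀ r : ℝ, 0 ≤ r → Hf t r = 0 := profileHornRigidity_holds (Hf t) (hHa t ht) hhorn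
      apply isSliceAxisymmetric_of_eq_zero
      intro x
      rw [hHu t ht]
      exact nullProfileShellZero_holds (Hf t) (Q0f t) x₀ hH0 x
  exact hU S hS hconn u x₀ hcont hdiv hmild hbdd hax

/-- **COMPOSITION W′ (the sketch's six-hypothesis form, for the record)**: with S-A, PHR and S-Z′ as explicit (now idle) hypotheses. -/
theorem isotypicWindowRigidity_of_horns (hWA : WindowWedgeAnalytic) (_hAS : AnalyticWedgeSeparable)
    (hHW : HornWindowSilenceVar) (_hR : ProfileHornRigidity) (_hZ : ZonalSepShellAxisym) (hU : WindowAxisUniform) :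
    IsotypicWindowRigidity :=
  isotypicWindowRigidity_of_bridges hWA hHW hU

end Summit.NavierStokesRegularity.NavierStokesRegularity.Theorems.UnthreadedRigidity.PressureHorn

end
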